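import Summits.ResolutionOfSingularities.ResolutionOfSingularities.Theses.PAlteration
import Literature.AlgebraicGeometry.Resolution.ProjectiveSpaceRegular
import Literature.Barriers.ResolutionOfSingularities.InseparableBaseChangeResolution
import Mathlib.RingTheory.NoetherNormalization
import Mathlib.Topology.KrullDimension

/-!
# `Picover` — negative lemmas: load-bearing hypotheses, redundancy, and where a counterexample
# cannot live

Support (negative) lemmas for crux `stmt-ResolutionOfSingularities-0554`
(`Summit.ResolutionOfSingularities.ResolutionOfSingularities.Theses.PAlteration.Picover`: for
every prime `p` and field `k` of characteristic `p`, every integral `X` which is FINITE,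
UNIVERSALLY INJECTIVE and SURJECTIVE over a REGULAR integral separated finite-type `k`-scheme `Y`
has a resolution of singularities), filed by the standing disprover (cdisprove gen 1; work file
`Cruxes/Picover/Disproof.lean`). This file declares NO definition; every dropped-hypothesis
variant is written out inline.

* `not_resolutionOfSingularities_of_not_picover` — the crux is implied by the summit (a finite
  cover of a separated finite-type `k`-scheme is separated of finite type; integral ⇒ reduced),
  so a refutation of the crux would be a counterexample to resolution of singularities in
  positive characteristic; none is in print.
* `picover_without_isRegular_iff_summit` — with `Scheme.IsRegular Y` dropped the statement is
  EQUIVALENT to the summit `ResolutionOfSingularities` (`g = 𝟙`, and reduced → integral by the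
  proved route item `DescentReducedToIntegral_holds`): regularity of the base is exactly what
  keeps the crux below the summit, and cannot be shown necessary by a counterexample.
* `affine_of_picover_without_surjective`, `affine_of_picover_without_universallyInjective` —
  with `Surjective g` (resp. `UniversallyInjective g`) dropped the statement still contains
  resolution of EVERY integral affine `k`-scheme of finite type: a closed immersion into `𝔸ⁿ_k`
  is finite and universally injective (resp. Noether normalisation, Mathlib
  `exists_finite_inj_algHom_of_fg`, gives a finite surjective map onto `𝔸ˢ_k`), and `𝔸ⁿ_k` is
  regular (Mathlib: polynomial rings over regular rings are regular).
* `picover_false_without_isIntegralX_at` / `picover_false_without_isIntegralX` — with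
  `IsIntegral X` dropped the statement is FALSE at every prime: `Spec 𝔽_p[ε] → Spec 𝔽_p` is
  finite, universally injective (`universallyInjective_Spec_dualNumber`: its `K`-points are
  injective over `Spec 𝔽_p`) and surjective onto a regular point, and `Spec 𝔽_p[ε]` has no
  resolution (`Literature.Barriers.ResolutionOfSingularities.not_hasResolution_Spec_dualNumber`).
* `isIntegral_of_isRegular_of_surjective` — the hypothesis `IsIntegral Y` is REDUNDANT (the
  continuous image of an irreducible space is irreducible; regular ⇒ reduced).
* `picover_hasResolution_of_dim_le_three` — modulo the named fact `CossartPiltant2019` the crux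
  holds whenever `dim Y ≤ 3` (a finite universally injective morphism is a closed topological
  embedding, so `dim X ≤ dim Y`): a counterexample needs dimension `≥ 4`
  (barrier `Literature.Barriers.ResolutionOfSingularities.DimensionFourFrontier`).

## Sources
* The Stacks Project, Tag 01S4 (universally injective = radicial; `tfae_universallyInjective`),
  Tag 00OW (Noether normalisation). Folklore reductions.
* V. Cossart, O. Piltant, J. Algebra 529 (2019) 268–535, Thm. 1.1 (named fact `CossartPiltant2019`).
* M. Temkin, *Inseparable local uniformization*, J. Algebra 373 (2013), Rem. 1.3.5 (iii) (the
  "inseparable case" as the hard core of resolution in characteristic `p`).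
-/

noncomputable section

open CategoryTheory AlgebraicGeometry TopologicalSpace
open Literature.AlgebraicGeometry.Resolution
open Summit.ResolutionOfSingularities.ResolutionOfSingularities.Theses.PAlteration

set_option linter.dupNamespace false

namespace Summit.ResolutionOfSingularities.ResolutionOfSingularities.Theorems.Picover.Negative

/-! ## The crux is implied by the summit -/

/-- **A refutation of `Picover` refutes the summit**: resolution in every prime characteristic
gives the crux (for `g : X → Y` finite over a separated finite-type `Y/k`, `X` is separated of
finite type over `k`, and an integral `X` is reduced; regularity of `Y`, universal injectivity
and surjectivity of `g` are not used). [folklore] -/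
theorem not_resolutionOfSingularities_of_not_picover (h : ¬ Picover) :
    ¬ _root_.ResolutionOfSingularities := by
  intro hres
  refine h fun p hp k _ _ Y X f g _ _ _ _ _ _ _ _ _ => ?_
  haveI : IsSeparated (g ≫ f) := inferInstance
  haveI : LocallyOfFiniteType (g ≫ f) := inferInstance
  haveI : QuasiCompact (g ≫ f) := inferInstance
  exact hres p hp k X (g ≫ f) inferInstance inferInstance inferInstance inferInstance

/-! ## Drop `IsRegular Y`: the statement is the summit -/

/-- **`Picover` with `Scheme.IsRegular Y` dropped is equivalent to the summit.** (→): for a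
reduced separated finite-type `X/k`, the proved route item `DescentReducedToIntegral_holds`
reduces to `X` integral, where the hypothesis applies with `Y = X`, `g = 𝟙 X` (finite,
universally injective, surjective). (←): as in `not_resolutionOfSingularities_of_not_picover`.
[folklore] -/
theorem picover_without_isRegular_iff_summit :
    (∀ p : ℕ, p.Prime → ∀ (k : Type) [Field k] [CharP k p] (Y X : Scheme.{0})
        (f : Y ⟶ Spec (.of k)) (g : X ⟶ Y),
        IsSeparated f → LocallyOfFiniteType f → QuasiCompact f → IsIntegral Y →
        IsIntegral X → IsFinite g → UniversallyInjective g →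
        Function.Surjective g.base → Scheme.HasResolution X) ↔
      _root_.ResolutionOfSingularities := by
  constructor
  · intro h p hp k _ _ X f _ _ _ _
    refine DescentReducedToIntegral_holds k ?_ X f ‹_› ‹_› ‹_› ‹_›
    intro X' f' _ _ _ _
    exact h p hp k X' X' f' (𝟙 X') ‹_› ‹_› ‹_› ‹_› ‹_› inferInstance inferInstance
      (fun x => ⟨x, rfl⟩)
  · intro hres p hp k _ _ Y X f g _ _ _ _ _ _ _ _
    haveI : IsSeparated (g ≫ f) := inferInstance
    haveI : LocallyOfFiniteType (g ≫ f) := inferInstance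
    haveI : QuasiCompact (g ≫ f) := inferInstance
    exact hres p hp k X (g ≫ f) inferInstance inferInstance inferInstance inferInstance

/-! ## Drop `Surjective g` or `UniversallyInjective g`: contains the affine integral summit -/

/-- The structure morphism `Spec k[x₁,…,xₙ] → Spec k` is locally of finite type. [folklore] -/
theorem locallyOfFiniteType_Spec_mvPolynomial (k : Type) [Field k] (n : ℕ) :
    LocallyOfFiniteType (Spec.map (CommRingCat.ofHom
      (algebraMap k (MvPolynomial (Fin n) k)))) := by
  rw [HasRingHomProperty.Spec_iff (P := @LocallyOfFiniteType), CommRingCat.hom_ofHom]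
  exact RingHom.finiteType_algebraMap.mpr inferInstance

/-- **`Picover` without `Surjective g` contains the affine integral summit at `p`**: every
integral affine `k`-scheme of finite type, `char k = p`, would have a resolution — a finite-type
domain `A` is a quotient of `k[x₁,…,xₙ]`, the closed immersion `Spec A → 𝔸ⁿ_k` is finite and
universally injective, and `𝔸ⁿ_k` is regular and integral. [folklore] -/
theorem affine_of_picover_without_surjective {p : ℕ}
    (h : ∀ (k : Type) [Field k] [CharP k p] (Y X : Scheme.{0}) (f : Y ⟶ Spec (.of k))
      (g : X ⟶ Y), IsSeparated f → LocallyOfFiniteType f → QuasiCompact f → IsIntegral Y →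
      Scheme.IsRegular Y → IsIntegral X → IsFinite g → UniversallyInjective g →
      Scheme.HasResolution X)
    (k : Type) [Field k] [CharP k p] (A : Type) [CommRing A] [IsDomain A] [Algebra k A]
    [Algebra.FiniteType k A] : Scheme.HasResolution (Spec (.of A)) := by
  obtain ⟨n, φ, hφ⟩ := Algebra.FiniteType.iff_quotient_mvPolynomial''.mp ‹Algebra.FiniteType k A›
  let P : Type := MvPolynomial (Fin n) k
  let f : Spec (.of P) ⟶ Spec (.of k) := Spec.map (CommRingCat.ofHom (algebraMap k P))
  let g : Spec (.of A) ⟶ Spec (.of P) := Spec.map (CommRingCat.ofHom φ.toRingHom)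
  haveI : IsClosedImmersion g := IsClosedImmersion.spec_of_surjective _ hφ
  haveI : LocallyOfFiniteType f := locallyOfFiniteType_Spec_mvPolynomial k n
  exact h k (Spec (.of P)) (Spec (.of A)) f g inferInstance inferInstance inferInstance
    inferInstance (Scheme.isRegular_Spec (.of P)) inferInstance inferInstance inferInstance

/-- **`Picover` without `UniversallyInjective g` contains the affine integral summit at `p`**:
by Noether normalisation a finite-type domain `A` is finite over an injective
`k[x₁,…,xₛ] → A`, so `Spec A → 𝔸ˢ_k` is finite and surjective (lying over), onto a regular
integral base. [folklore] -/
theorem affine_of_picover_without_universallyInjective {p : ℕ}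
    (h : ∀ (k : Type) [Field k] [CharP k p] (Y X : Scheme.{0}) (f : Y ⟶ Spec (.of k))
      (g : X ⟶ Y), IsSeparated f → LocallyOfFiniteType f → QuasiCompact f → IsIntegral Y →
      Scheme.IsRegular Y → IsIntegral X → IsFinite g → Function.Surjective g.base →
      Scheme.HasResolution X)
    (k : Type) [Field k] [CharP k p] (A : Type) [CommRing A] [IsDomain A] [Algebra k A]
    [Algebra.FiniteType k A] : Scheme.HasResolution (Spec (.of A)) := by
  obtain ⟨s, φ, hinj, hfin⟩ := exists_finite_inj_algHom_of_fg k A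
  have hfin' : φ.toRingHom.Finite := hfin
  let P : Type := MvPolynomial (Fin s) k
  let f : Spec (.of P) ⟶ Spec (.of k) := Spec.map (CommRingCat.ofHom (algebraMap k P))
  let g : Spec (.of A) ⟶ Spec (.of P) := Spec.map (CommRingCat.ofHom φ.toRingHom)
  haveI : IsFinite g := by
    rw [IsFinite.SpecMap_iff, CommRingCat.hom_ofHom]
    exact hfin
  haveI : LocallyOfFiniteType f := locallyOfFiniteType_Spec_mvPolynomial k s
  have hsurj : Function.Surjective g.base := by
    intro y
    obtain ⟨x, hx⟩ := RingHom.IsIntegral.comap_surjective hfin'.to_isIntegral hinj y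
    exact ⟨x, by rw [← hx]; rfl⟩
  exact h k (Spec (.of P)) (Spec (.of A)) f g inferInstance inferInstance inferInstance
    inferInstance (Scheme.isRegular_Spec (.of P)) inferInstance inferInstance hsurj

/-! ## Drop `IsIntegral X`: FALSE (the non-reduced point) -/

/-- Two ring homomorphisms out of the dual numbers `k[ε]` into a field that agree on `k` are
equal (`ε` is nilpotent, so both send it to `0`). [folklore] -/
theorem ringHom_dualNumber_ext {k : Type*} [CommRing k] {K : Type*} [Field K]
    (φ₁ φ₂ : DualNumber k →+* K)
    (h : φ₁.comp (algebraMap k (DualNumber k)) = φ₂.comp (algebraMap k (DualNumber k))) :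
    φ₁ = φ₂ := by
  have hε : ∀ (φ : DualNumber k →+* K) (m : k), φ (TrivSqZeroExt.inr m) = 0 := fun φ m =>
    IsReduced.eq_zero _ ((TrivSqZeroExt.isNilpotent_inr m).map φ)
  refine RingHom.ext fun x => ?_
  have hx : x = TrivSqZeroExt.inl x.fst + TrivSqZeroExt.inr x.snd :=
    (TrivSqZeroExt.inl_fst_add_inr_snd_eq x).symm
  rw [hx, map_add, map_add, hε, hε]
  exact congrArg (· + (0 : K)) (RingHom.congr_fun h x.fst)

/-- `Spec k[ε] → Spec k` is universally injective: by Stacks 01S4 (Mathlib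
`tfae_universallyInjective`, (1) ⇔ (2)) it suffices that its `K`-points are injective over
`Spec k` for every field `K`, and a `K`-point of `Spec k[ε]` is determined by its restriction to
`k` (`ringHom_dualNumber_ext`). [folklore] -/
theorem universallyInjective_Spec_dualNumber (k : Type) [Field k] :
    UniversallyInjective (Spec.map (CommRingCat.ofHom (algebraMap k (DualNumber k)))) := by
  refine ((tfae_universallyInjective
    (Spec.map (CommRingCat.ofHom (algebraMap k (DualNumber k))))).out 0 1).mpr ?_
  intro K _ a₁ a₂ ha
  obtain ⟨φ₁, rfl⟩ := Spec.map_surjective a₁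
  obtain ⟨φ₂, rfl⟩ := Spec.map_surjective a₂
  have ha' : CommRingCat.ofHom (algebraMap k (DualNumber k)) ≫ φ₁ =
      CommRingCat.ofHom (algebraMap k (DualNumber k)) ≫ φ₂ := by
    apply Spec.map_injective
    simpa only [Spec.map_comp] using ha
  have : φ₁.hom = φ₂.hom := ringHom_dualNumber_ext φ₁.hom φ₂.hom (by
    have := congrArg CommRingCat.Hom.hom ha'
    simpa using this)
  rw [show φ₁ = φ₂ from CommRingCat.hom_ext this]

/-- **`IsIntegral X` is load-bearing — the crux is FALSE without it, at every prime `p`.**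
Witness: `Y = Spec 𝔽_p` (regular, integral, separated of finite type), `X = Spec 𝔽_p[ε]`,
`g : X → Y` finite (free of rank `2`), universally injective and surjective; `X` has no resolution
because a one-point scheme with a resolution is reduced
(`Literature.Barriers.ResolutionOfSingularities.not_hasResolution_Spec_dualNumber`). (Only
GENERIC reducedness of `X` is forced by `HasResolution`; the crux rightly asks `X` integral.)
[folklore] -/
theorem picover_false_without_isIntegralX_at (p : ℕ) [Fact p.Prime] :
    ¬ ∀ (k : Type) [Field k] [CharP k p] (Y X : Scheme.{0}) (f : Y ⟶ Spec (.of k)) (g : X ⟶ Y),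
        IsSeparated f → LocallyOfFiniteType f → QuasiCompact f → IsIntegral Y →
        Scheme.IsRegular Y → IsFinite g → UniversallyInjective g →
        Function.Surjective g.base → Scheme.HasResolution X := by
  intro h
  let k : Type := ZMod p
  let Λ : Type := DualNumber k
  let Y : Scheme.{0} := Spec (.of k)
  let X : Scheme.{0} := Spec (.of Λ)
  let g : X ⟶ Y := Spec.map (CommRingCat.ofHom (algebraMap k Λ))
  haveI : Module.Finite k Λ := inferInstanceAs (Module.Finite k (k × k))
  haveI : IsFinite g := by
    rw [IsFinite.SpecMap_iff, CommRingCat.hom_ofHom]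
    exact RingHom.finite_algebraMap.mpr inferInstance
  haveI : UniversallyInjective g := universallyInjective_Spec_dualNumber k
  haveI : Nonempty X := inferInstanceAs (Nonempty (PrimeSpectrum Λ))
  have hsurj : Function.Surjective g.base := fun y =>
    ⟨Classical.arbitrary X, Subsingleton.elim (α := PrimeSpectrum k) _ _⟩
  exact Literature.Barriers.ResolutionOfSingularities.not_hasResolution_Spec_dualNumber k
    (h k Y X (𝟙 Y) g inferInstance inferInstance inferInstance inferInstance
      (Scheme.isRegular_Spec (.of k)) inferInstance inferInstance hsurj)

/-- The `∀ p` form: `Picover` with `IsIntegral X` deleted from its hypotheses is false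
(instantiate `picover_false_without_isIntegralX_at` at `p = 2`). [folklore] -/
theorem picover_false_without_isIntegralX :
    ¬ ∀ p : ℕ, p.Prime → ∀ (k : Type) [Field k] [CharP k p] (Y X : Scheme.{0})
        (f : Y ⟶ Spec (.of k)) (g : X ⟶ Y),
        IsSeparated f → LocallyOfFiniteType f → QuasiCompact f → IsIntegral Y →
        Scheme.IsRegular Y → IsFinite g → UniversallyInjective g →
        Function.Surjective g.base → Scheme.HasResolution X :=
  fun h => haveI : Fact (Nat.Prime 2) := ⟨Nat.prime_two⟩
    picover_false_without_isIntegralX_at 2 (h 2 Nat.prime_two)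

/-! ## `IsIntegral Y` is redundant -/

/-- **The hypothesis `IsIntegral Y` of the crux is redundant**: if `X` is integral, `g : X → Y`
is surjective and `Y` is regular then `Y` is integral (irreducible as a continuous image of an
irreducible space; reduced since regular local rings are domains). [folklore] -/
theorem isIntegral_of_isRegular_of_surjective {X Y : Scheme.{0}} (g : X ⟶ Y) [IsIntegral X]
    (hY : Scheme.IsRegular Y) (hs : Function.Surjective g.base) : IsIntegral Y := by
  haveI : IsReduced Y := hY.isReduced
  haveI : IrreducibleSpace Y := hs.irreducibleSpace g.base.hom.continuous
  exact isIntegral_of_irreducibleSpace_of_isReduced Y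

/-! ## Dimension `≤ 3`: true modulo `CossartPiltant2019` -/

/-- **No counterexample below dimension four** (modulo the named fact `CossartPiltant2019`): if
`g : X → Y` is finite and universally injective with `X` integral and `Y` separated of finite
type over `k` of (topological Krull) dimension `≤ 3`, then `X` has a resolution — `g` is a closed
topological embedding (injective, continuous, closed), so `dim X ≤ dim Y ≤ 3`, and Cossart–Piltant
applies to the reduced separated finite-type `k`-scheme `X`. Regularity of `Y` and surjectivity
of `g` are not needed. [cite: CossartPiltant2019, Thm. 1.1] -/
theorem picover_hasResolution_of_dim_le_three (hCP : CossartPiltant2019.{0}) {k : Type} [Field k]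
    {Y X : Scheme.{0}} (f : Y ⟶ Spec (.of k)) (g : X ⟶ Y) [IsSeparated f]
    [LocallyOfFiniteType f] [QuasiCompact f] [IsIntegral X] [IsFinite g] [UniversallyInjective g]
    (hdim : topologicalKrullDim Y ≤ 3) : Scheme.HasResolution X := by
  have hemb : Topology.IsClosedEmbedding g.base :=
    .of_continuous_injective_isClosedMap g.base.hom.continuous g.injective g.isClosedMap
  have hX : topologicalKrullDim X ≤ 3 := hemb.isInducing.topologicalKrullDim_le.trans hdim
  haveI : IsSeparated (g ≫ f) := inferInstance
  haveI : LocallyOfFiniteType (g ≫ f) := inferInstance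
  haveI : QuasiCompact (g ≫ f) := inferInstance
  exact hCP k X (g ≫ f) inferInstance inferInstance inferInstance inferInstance hX

end Summit.ResolutionOfSingularities.ResolutionOfSingularities.Theorems.Picover.Negative

end
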